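import Mathlib
import HarnessLib
import HarnessLib.Audit
import Summits.CriticalPhenomena.Statement
import Literature.Probability.RandomPlanarGeometry.CurveTightness
import Literature.Probability.RandomPlanarGeometry.SAWWordBridges
import Literature.Probability.RandomPlanarGeometry.SLEUniquenessInLaw
import HarnessLib.Audit.Status.Attr

/-!
Route: SAWRenewalTightness

DORMANT since 2026-08-26T04:21:24Z (reconciler: no traction for 8.3 d (last activity item-evidence-added at 2026-08-17T19:24:59Z); parked, not closed — `ledger route dormant route-CriticalPhenomena-SAWRenewalTightness --off` to reactiva) — unstaffed, not closed; items shared with open routes are served there. `ledger route dormant <id> --off` reactivates.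

# Route SAWRenewalTightness — Tightness of the critical Z^2 SAW from Kesten's renewal identity — an
annular RSW pair plus surgery feeding Aizenman–Burchard; identification imported

It suffices to show X = (T′) ∧ (I), realising card saw-rsw-from-kesten-renewal-tightness:
 (T′) EventualTight — for every Dobrushin domain and endpoint approximation there is δ₀ > 0 such
that the critical δℤ² SAW laws
      (Literature.Probability.RandomPlanarGeometry.SAW.law, pushed to CurveClass ℂ), δ ∈ (0, δ₀],
form a tight set of measures.
      This is the CORRECTED precompactness statement: the all-δ form `Tight`
(stmt-CriticalPhenomena-0772) is refuted
      (Theorems/SAWParafermionTightRefutation: coincident far endpoints at δ ∈ (1/2,1]); T′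
quantifies δ below a threshold, as the
      refuting theorem itself recommends. T′ is THIS route's content, attacked by the card's
mechanism (cruxes r2–r4).
 (I)  SubseqIdentification — every subsequential weak limit of the SAW laws along δ_n → 0⁺ is the
chordal SLE_{8/3} law
      (shared decl, identical to SAWParafermion.SubseqIdentification; imported, ranked last here).
Then Prokhorov on the Polish space CurveClass ℂ (CurveClass.polishSpace_holds), uniqueness/existence
of the SLE_{8/3} law
(IsSLECurve.map_eq_holds, exists_isSLECurve_eightThirds — all PROVED in tree) and the subsequence
principle along 𝓝[>]0 give
SAWScalingLimit. The mechanism for T′: r2 ShellCrossingBound (Aizenman–Burchard hypothesis (H1) for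
the SAW: a power bound
K(ρ/R)^λ, λ > 2, on k-fold shell traversals, exactly the input of the PROVED criterion
Literature.Probability.RandomPlanarGeometry.isTightMeasureSet_of_traversalBounds) obtained from the
SAW-RSW pair r3 AnnularMassDecay
(x_c-mass of annular bridges from a point decays like (r/R)^θ — Kesten's mass conservation Σ_irr
x_c^|β| = 1 transported from
strips to annuli) and r4 TubeLowerBound (polynomial lower bound for constrained connections) through
a Kesten-1987 /
Duminil-Copin–Hammond-type surgery (support SurgeryReduction, the foreseen glue).
Lean: `(∀ (D : Literature.Probability.RandomPlanarGeometry.DobrushinDomain) (a b : ℝ →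
Literature.Probability.LatticeModels.Site 2),
Literature.Probability.RandomPlanarGeometry.SAW.IsEndpointApprox D a b → ∃ δ₀ : ℝ, 0 < δ₀ ∧
MeasureTheory.IsTightMeasureSet ((fun δ => (Literature.Probability.RandomPlanarGeometry.SAW.law
D.carrier δ (a δ) (b δ)).map (fun γ => γ.curve)) '' Set.Ioc 0 δ₀)) ∧ (∀ (D :
Literature.Probability.RandomPlanarGeometry.DobrushinDomain) (a b : ℝ →
Literature.Probability.LatticeModels.Site 2),
Literature.Probability.RandomPlanarGeometry.SAW.IsEndpointApprox D a b → ∀ (s : ℕ → ℝ) (μ :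
MeasureTheory.Measure (Literature.Probability.RandomPlanarGeometry.CurveClass ℂ)), Filter.Tendsto s
Filter.atTop (nhdsWithin 0 (Set.Ioi 0)) → MeasureTheory.IsProbabilityMeasure μ → (∀ f :
BoundedContinuousFunction (Literature.Probability.RandomPlanarGeometry.CurveClass ℂ) ℝ,
Filter.Tendsto (fun n => ∫ γ, f γ.curve ∂(Literature.Probability.RandomPlanarGeometry.SAW.law
D.carrier (s n) (a (s n)) (b (s n)))) Filter.atTop (nhds (∫ x, f x ∂μ))) →
Literature.Probability.RandomPlanarGeometry.IsSLELaw ((8 : NNReal) / 3) D μ)`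

## Assembly
EventualTight → SubseqIdentification → SAWScalingLimit. For (D, a, b) with IsEndpointApprox: the
laws are probability measures for
small δ (IsEndpointApprox.reachable gives a SAW, DomainSAW is finite for bounded Ω so the total
weight is finite and positive);
ConvergesInLawToSLE (8/3) asks for an SLE curve Γ (exists_isSLECurve_eightThirds, proved), eventual
AEMeasurable (automatic,
SAW.aemeasurable_curve) and TendstoLaw along 𝓝[>]0. Suppose ∫ f∘curve dP_δ does not tend to ∫ f
d(SLE law): pick δ_n → 0⁺ staying
ε-away (𝓝[>]0 is countably generated); EventualTight + Prokhorov on the Polish CurveClass ℂ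
(CurveClass.polishSpace_holds) extract a
weakly convergent subsequence with a probability limit μ (no mass loss under tightness);
SubseqIdentification makes μ an SLE_{8/3} law,
equal to preWienerMeasure.map Γ by IsSLECurve.map_eq_holds — contradiction. Standard reductions only
(Prokhorov, portmanteau,
subsequence principle); every named fact used is proved in tree.

Rationale: WHY THIS LINE. Every interface-to-SLE theorem needs precompactness, and for the critical ℤ² SAW no
annulus-crossing bound is in print
(KemppainenSmirnov2017 §4 verifies Condition G2 for FK/percolation/harmonic explorer/LERW — SAW
absent; the strongest unconditional
geometric input is sub-ballisticity, DuminilCopinHammond2013, and on the hexagonal lattice only,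
quantitative bridge decay
arXiv:2310.17299 / arXiv:1109.0358 via the parafermion). The SAW has neither the Markov property
(random walk: hitting
probabilities ≤ 1) nor FKG/duality (percolation RSW) on which all existing tightness proofs rest;
the card's observation is that
Kesten's exact criticality identity Σ_{irreducible bridges} x_c^{|β|} = 1 (Kesten1963SAW;
MadrasSlade1993 (4.2.4), from
Cor. 3.1.8) IS a mass-conservation law — the x_c-mass of bridges of span L from a point is a renewal
probability u_L ≤ 1 — and
that an annular version of it (r3) plus polynomial lower bounds (r4) is exactly the RSW-type pair
that multi-valued-map surgery
(Kesten1987 separation; DuminilCopinHammond2013, arXiv:1305.1257, arXiv:1504.05286, arXiv:1809.00760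
already prove POLYNOMIAL
statements at x_c on ℤ² this way) converts into Aizenman–Burchard k-crossing exponents
(AizenmanBurchardDuke1999, in tree and
proved). Imported areas: renewal theory (Kesten/Madras–Slade), AB/KS weak-convergence machinery.
What it does that prior routes
do not: SAWParafermion/SAWConfRestriction list tightness as "intended tools, not in print" with a
refuted all-δ signature; this
route names the mechanism, types the AB input in the form the proved criterion consumes, and uses
the eventual quantifier that
avoids the recorded witness (negatives index: stmt-CriticalPhenomena-0772).

RANKED CRUXES. #0 EventualTight (target) — (T′, the half of X this route owns) for every Dobrushin
domain D and endpoint approximation (a_δ, b_δ) (SAW.IsEndpointApprox) there is δ₀ > 0 such that the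
push-forwards to CurveClass ℂ of the critical SAW laws SAW.law D δ a_δ b_δ, δ ∈ (0, δ₀], form a
tight set of measures (Mathlib IsTightMeasureSet) — the eventual form recommended by the refuting
theorem of the all-δ `Tight` (stmt-CriticalPhenomena-0772). X = EventualTight ∧
SubseqIdentification. (why it might fail: Needs an Aizenman–Burchard/KS crossing bound for x_c-SAW
that is proved on no lattice (KS17 §4 omits SAW); true if the conjunct is (a converging family of
lattice polylines is eventually tight), so a refutation would kill the conjunct itself.)
[KemppainenSmirnov2017, AizenmanBurchardDuke1999,
Summit.CriticalPhenomena.SAWScalingLimit.Theorems.SAWParafermionTight_refuted,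
DuminilCopinHammond2013]
#2 ShellCrossingBound (crux) — (card E3 output; Aizenman–Burchard (H1) for the SAW) for every
Dobrushin domain D and endpoint approximation (a_δ,b_δ) there are a shell-dependent threshold k : ℂ
→ ℝ → ℝ → ℕ, constants K, λ > 2 and δ₀ > 0 such that for all δ ∈ (0,δ₀], all x ∈ ℂ and δ ≤ ρ < R ≤
1: P_δ[the SAW polyline traverses the shell D(x; ρ, R) by k(x,ρ,R) separate segments] ≤ K (ρ/R)^λ
(Curve.HasTraversals of CurveTortuosity.lean). k may depend on the shell because ∂Ω (fjords,
oscillating corridors near a) can force any fixed finite number of traversals deterministically —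
exactly the freedom the in-tree criterion isTightMeasureSet_of_traversalBounds allows. [deps:
AnnularMassDecay, TubeLowerBound] [difficulty: open-problem] (why it might fail: Uniformity down to
ρ = δ and up to ∂Ω with λ > 2: no a-priori arm bound for x_c-SAW exists on any lattice (KS17 §4
omits SAW; hex has only bridge decay); near wild Jordan boundaries forced traversals are unbounded
over shells (k shell-dependent absorbs this only if finite per shell uniformly in δ).)
[AizenmanBurchardDuke1999, KemppainenSmirnov2017, DuminilCopinHammond2013, arXiv:2310.17299,
Literature.Probability.RandomPlanarGeometry.isTightMeasureSet_of_traversalBounds]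
#3 AnnularMassDecay (crux) — (card E1, SAW-RSW upper bound = annular mass conservation; lattice
units on ℤ², scale-free) there are θ > 0 and C such that for every centre z ∈ ℂ, radii 1 ≤ r < R and
start vertex u with |u − z| ≥ R, the x_c-mass Σ x_c^{|ω|} over self-avoiding walks ω from u whose
interior vertices lie in the open annulus r < |· − z| < R and whose last vertex lies in |· − z| ≤ r
("annular bridges": the radius is maximal at the start and minimal at the end, the exact analogue of
Kesten's bridges, which in a straight strip have x_c-mass u_L ≤ 1 by Σ_irr x_c^|β| = 1) is ≤ C
(r/R)^θ (all partial sums; x_c = SAW.criticalFugacity). [deps: KestenIdentity,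
StripMassConservation] [difficulty: open-problem] (why it might fail: Curvature kills the exact
renewal decomposition; θ>0 is a radial form of 'bridge partition function of height T → 0
polynomially at x_c', open on ℤ² (MadrasSlade1993 p.92 'believed, no known proof'; arXiv:2310.17299
p.2 'a major obstacle'; hex only, via parafermion). Even θ=0 is unproved.) [Kesten1963SAW,
MadrasSlade1993 §4.2 (4.2.4) and Cor. 3.1.8 and p.92, arXiv:2310.17299 p.2 and Thm 2 (hexagonal
bridge decay), arXiv:1109.0358, GlazmanManolescu2019 Thm 2, LawlerSchrammWerner2004SAW]
#4 TubeLowerBound (crux) — (card E2, SAW-RSW lower bound) there are C and c > 0 such that for all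
vertices u, v of ℤ² and ℓ ≥ 1 with |u − v| ≤ ℓ, the x_c-mass of self-avoiding walks from u to v all
of whose vertices stay within distance ℓ/10 + 2 of the segment [u, v] is ≥ c ℓ^{−C} (some partial
sum already exceeds the bound). Implies the card's obstacle form (K at distance ≥ ℓ/10 from [u,v] is
not met) and is what the surgery needs to re-glue a walk after excising an annular excursion. [deps:
KestenIdentity] [difficulty: L] (why it might fail: Only exponential-scale lower bounds are
classical (μ^n e^-c√n ≤ b_n; Σ_L≤Λ u_L ≳ ½log Λ from MS (3.1.14)); a POINTWISE polynomial lower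
bound for point-to-point x_c-masses, let alone inside a tube of fixed aspect ratio, is not in print
for ℤ².) [MadrasSlade1993 Cor. 3.1.6 and (3.1.14), DuminilCopinHammond2013, arXiv:1305.1257,
arXiv:1809.00760]
#5 SubseqIdentification (crux) — (imported, shared with SAWParafermion r3; identical decl body so
the ledger dedups) for every Dobrushin domain, endpoint approximation, sequence s_n → 0⁺ and
probability measure μ on CurveClass ℂ: if ∫ f∘curve dP_{s_n} → ∫ f dμ for all bounded continuous f
then μ is the chordal SLE_{8/3} law in D (IsSLELaw (8/3) D μ). This route contributes nothing new to
it beyond delivering its natural companion (Loewner regularity of subsequential limits via KS Cor.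
1.7 once r2 holds); ranked last. [difficulty: open-problem] (why it might fail: Unconditional over
arbitrary subsequential μ: print gives SLE_8/3 only IF the limit is conformally covariant (LSW04
Prediction 1); on ℤ² no observable; embedding-blind inputs cannot produce rotation covariance
(EmbeddingModulusUniqueness).) [LawlerSchrammWerner2004SAW, LawlerSchrammWerner2003Restriction,
DuminilCopinSmirnov2012, Literature.Barriers.CriticalPhenomena.EmbeddingModulusUniqueness]
#9 SurgeryReduction (support) — (card E3, the foreseen glue of the split r2 ⇐ r3, r4)
AnnularMassDecay → TubeLowerBound → ShellCrossingBound: a k-fold traversal of D(x;ρ,R) by the SAW in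
Ω_δ contains k disjoint annular bridges alternating in direction; excise an in–out pair, re-glue
through a tube connector (TubeLowerBound pays ℓ^-C), and bound the multiplicity of the multi-valued
map by the x_c-mass of the excised double excursion (AnnularMassDecay pays (ρ/R)^θ per pair,
uniformly in the slit domain by monotonicity in the domain); iterate: λ_k ≥ cθk − C′, choose k with
λ_k > 2. Filed as support so that anyone may attempt it; it becomes the glue item of `route edit
--split ShellCrossingBound --into AnnularMassDecay TubeLowerBound` once r3 or r4 has traction.
[difficulty: XL] [Kesten1987, DuminilCopinHammond2013, arXiv:1305.1257, arXiv:1504.05286,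
AizenmanBurchardDuke1999]
#9 TightOfShellCrossing (support) — ShellCrossingBound → EventualTight, by the PROVED
Aizenman–Burchard criterion isTightMeasureSet_of_traversalBounds with Λ = closure of a bounded
neighbourhood of Ω (compact), d = 2 covering numbers (exists_finset_card_le_cover_closedBall), T =
(0, δ₀], X_δ = the SAW polyline; hypothesis (H0) (no k traversals of shells of inner radius ≤ δ)
holds for self-avoiding polylines of step δ once k exceeds an absolute constant (a SAW uses each of
the ≤ 12 edges within δ of x at most once), so replace k by max k k₀ using HasTraversals.of_le.
[difficulty: provable-now] [AizenmanBurchardDuke1999,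
Literature.Probability.RandomPlanarGeometry.isTightMeasureSet_of_traversalBounds,
Literature.Probability.RandomPlanarGeometry.exists_finset_card_le_cover_closedBall]
#9 KestenIdentity (support) — Kesten's criticality identity Σ_{β irreducible bridge} x_c^{|β|} = 1
(HasSum over the word model SAW.IsIrrBridge of SAWWordBridges.lean): MadrasSlade1993 (4.2.4) —
A_{z_c} ≤ 1 from b_n ≤ μ^n (in tree: Zd.bridgeCount_le_pow) and the renewal equation B = 1/(1−A)
with unique decoding (in tree: Renewal.eq_of_append_eq), A_{z_c} ≥ 1 because B_z diverges at z_c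
(Cor. 3.1.8: every half-space walk decomposes into bridges of distinct spans, H_z ≤ exp(B_z − 1),
and χ(z) ≥ z_c/(z_c − z), in tree: criticalPoint_div_le_susceptibility, count_le_sum_halfSpaceCount,
unfold_code_injOn). The tool behind r3; a known theorem, hence support. [difficulty: M]
[Kesten1963SAW, MadrasSlade1993 (4.2.4) and Cor. 3.1.8]
#9 StripMassConservation (support) — the strip prototype of r3: for every span L ≥ 1 the x_c-mass of
bridges of span L from the origin (vertex-function bridges Zd.bridges of SAWBridges.lean, span =
first coordinate of the endpoint) is ≤ 1 (all partial sums) — the span-renewal probability u_L of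
the renewal process with inter-arrival law p_ℓ = A_{z_c}(span ℓ), Σ p_ℓ = 1 by KestenIdentity
(MadrasSlade1993 (4.2.9)–(4.2.12) at z = z_c, m(z_c) = 0). [difficulty: M] [MadrasSlade1993 §4.2
(4.2.9)-(4.2.12), Kesten1963SAW]

TWO-LAYER PLAN. Foreseen glued split (filed as the support item SurgeryReduction now, promoted to
the glue of `route edit --split ShellCrossingBound
--into AnnularMassDecay TubeLowerBound` when r3 or r4 gains traction): ShellCrossingBound ⇐
AnnularMassDecay → TubeLowerBound →
ShellCrossingBound. If AnnularMassDecay closes first with an explicit θ, its branch expands into (i)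
the slit-domain/monotonicity
lemma and (ii) the pair bound for in–out double excursions; if TubeLowerBound closes first, the
connector lemma inside D ∖ γ[0,τ].
TightOfShellCrossing is provable now and needs no split.

KILL CRITERIA. ¬AnnularMassDecay (annular-bridge mass from a point growing with r at fixed aspect
ratio, or decaying slower than every power in
r/R) kills the mechanism: close `refuted:AnnularMassDecay` unless the refutation only concerns the
normalisation (then pivot:
renormalise by the boundary one-leg factor and restate r3 as a PAIR bound for in–out double
excursions, which is what the surgery
actually consumes). ¬ShellCrossingBound with a witness domain whose boundary forces unboundedly many
traversals at fixed δ would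
be a typing defect (restate with Λ-interior shells); a witness in the bulk refutes AB-type tightness
for SAW outright and is major
news — close the route. ¬TubeLowerBound (super-polynomial decay of constrained connections) forces a
pivot to averaged lower bounds
(Σ_{ℓ≤Λ} ≥ c log Λ, MS (3.1.14)) and a weaker surgery. ¬EventualTight or ¬SubseqIdentification
refute the conjunct as typed (every
route dies). If SAWParafermion's KSConditionG2 is proved first, T′ follows from it (KS Thm 1.5) and
this route is superseded for T′
(close --reason superseded) while r3/r4 keep independent value as SAW estimates.

NOT DECOMPOSED YET. The surgery itself (SurgeryReduction is one support item, not a family):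
planarity bookkeeping of nested excursions of the SAME walk,
the entropy of the junction location versus the scale-invariant gain (the known danger: a local
re-gluing must be recognisable from
the image walk up to a factor the (ρ/R)^θ gain beats), the slit-domain version of r3 (monotone in
the domain, so free space
suffices — to be checked when filed), boundary shells near a, b (absorbed in the shell-dependent
threshold k), the KS Condition
G2 / Loewner-regularity by-product (useful to identification routes; not needed by this Assembly),
and the renewal-skeleton
by-product E5 of the card (a published conjecture, Gilbert arXiv:1410.4796; not filed). Constants θ,
λ, k are existential on purpose.

CHEAPEST FALSIFIER. Exact enumeration / transfer matrices for r3 at aspect ratio 2: compute the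
annular-bridge x_c-mass M(r, 2r) from a boundary
point for r ≤ 10–12 on ℤ² (x_c ≈ 0.379052; finite-lattice method or Jensen-type transfer matrices in
an annulus, or Kennedy's
pivot sampling of x_c-ensembles arXiv:1110.4167); prediction M ≍ r^{−1/4}·2^{−35/48} decreasing in
r. A mass INCREASING in r kills
r3 as stated (pivot to the pair form). Second cheapest: the strip sanity check StripMassConservation
(u_L ≤ 1, and u_L ≍ L^{−1/4}
numerically, DGKLP arXiv:1008.4321) — a failure there would mean a typing error, since it is a
theorem. Not run here (hub is
compute-free for planners in plancard mode; recorded for the refuter).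

NUMBERS. x_c = 1/μ(ℤ²), μ ∈ [2.625622, 2.679193] (BDGS2012 (1.14)), in tree unconditionally x_c ∈
[1/3, 1/2]. AB needs λ > d = 2 for ONE
threshold k (in-tree criterion). Predicted exponents (Coulomb-gas/SLE_{8/3} heuristics,
Duplantier–Saleur polymer network exponents
x_L = (9L² − 4)/48: x_1 = 5/48, x_2 = 2/3, x_4 = 35/12, x_6 = 20/3; boundary one-leg b = 5/8,
LSW04): bulk probability of 2j
shell crossings ≍ (ρ/R)^{x_{2j}}, so k = 4 traversals already give λ = 35/12 > 2 with margin 11/12;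
annular-bridge mass from a
boundary point ≍ (r/R)^{35/48} r^{−1/4} (θ_pred = 35/48; r3 asks θ > 0); strip: u_L ≍ L^{−1/4}
(DGKLP arXiv:1008.4321,
Gilbert arXiv:1410.4796: renewal heights with tail H^{−3/4}). Sub-ballisticity
(DuminilCopinHammond2013) and P(end adjacent) ≤
n^{−1/4+o(1)}-type bounds (arXiv:1305.1257) are the polynomial statements the surgery technology has
delivered so far.

DEFINITION REQUESTS. None needed to type the items (annuli, traversals, bridges, irreducible
bridges, x_c all exist: CrossingCondition.lean,
CurveTortuosity.lean, SAWBridges.lean, SAWWordBridges.lean, SelfAvoidingWalk.lean). Nice-to-have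
later: a named `SAW.annularBridgeMass
z r R u` wrapping the double sum of r3, and `KSConditionG3` if the Loewner-regularity by-product is
filed.

Novelty: Searches (2026-08-15): `lit search --hybrid "critical self-avoiding walk annulus crossing tightness
Aizenman Burchard bridges renewal"`
(12 local book hits: Lawler 2005, Madras–Slade 1993, Slade 2006 — none with an SAW crossing bound);
`lit search --source zbmath
"self-avoiding walk bridge critical square lattice"` (0); `lit search --source crossref
"self-avoiding walk annulus crossing probability
critical"` (10, off-topic; noted Hutchcroft doi:10.1214/17-ecp94 HW revisited); `lit search --source
zbmath "self-avoiding walk critical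
two-point function"` (10: lace-expansion/high-d only); arXiv API rate-limited today; `ledger
negatives --problem CriticalPhenomena` (1:
stmt-0772); plus the card's audited record (refuter-novelty-audit 2026-08-15: lit read
arXiv:1410.4796 §1/App. A, arXiv:math/0204277
appendix, KS arXiv:1212.6215 §4, zbMATH/Crossref DGHM and bridge-decay queries).
Nearest prior art found: arXiv:1205.0401 (DuminilCopinHammond2013) and arXiv:1305.1257 (renewal +
unfolding multi-valued-map surgery
proving polynomial bounds at x_c on ℤ²); arXiv:1212.6215 (KemppainenSmirnov2017: the tightness
framework, SAW absent from §4);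
AizenmanBurchardDuke1999 (in tree); MadrasSlade1993 §4.2 / Kesten1963SAW (the identity);
arXiv:1410.4796 + arXiv:math/0204277 appendix
+ arXiv:1008.4321 (the renewal-skeleton / u_L ≍ L^−1/4 predictions, KNOWN — hence not filed);
arXiv:2310.17299, arXiv:1109.0358,
GlazmanManolescu2019 Thm 2 (bridge decay where a parafermion exists).
Delta: nobody in t  [refs: 10.1214/17-ecp94, 1410.4796, math/0204277, 1212.6215, 1205.0401, 1305.1257, 1008.4321, 2310.17299, 1109.0358, doi:10.1214/17-ecp94, DuminilCopinHammond2013, KemppainenSmirnov2017, AizenmanBurchardDuke1999, MadrasSlade1993, GlazmanManolescu2019]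

Barriers (technique_class: bridge-renewal, annular-surgery, AB-tightness): - technique_class: bridge-renewal, annular-surgery, AB-tightness
- Literature.Barriers.CriticalPhenomena.EmbeddingModulusUniqueness: does not bite — tightness (T′)
and r2–r4 are embedding-blind statements that MAY be proved by shear-invariant means; the barrier
forbids only deriving conformal invariance that way, which this route imports as (I) and does not
attempt.
- Literature.Barriers.CriticalPhenomena.SupercriticalSAWSpaceFilling: r3 is false for x > x_c
(masses blow up, DKY space-filling) and r2 fails there; every estimate is pinned to x_c through
Kesten's identity Σ x_c^|β| = 1 (KestenIdentity), which holds at x_c only — nothing here is open in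
the fugacity.
- Literature.Barriers.CriticalPhenomena.SAWNotKineticallyGrown: no growth rule is used; the only
Markov-type structure is conditioning of the configurational x_c-law on an initial segment (domain
Markov in the slit domain), which is how AB/KS consume crossing bounds.
- Literature.Barriers.CriticalPhenomena.NienhuisWeightsExcludeVertexSAW: no observable and no vertex
relation on ℤ² is used; consequently the hexagonal bridge-decay proofs (parafermionic) do NOT
transfer and r3's decay is a genuine crux, not a transcription — it does not evade the absence of
integrability; the bet is that mass conservation + surgery suffice for POLYNOMIAL (not exact)
statements, as in DuminilCopinHammond2013.
- Literature.Barriers.CriticalPhenomena.ParafermionicHalfCauchyRiemann: same remark; nothing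
discrete-holomorphic is invoked.
- N

History (route lifecycle, newest last):
- 2026-08-16T04:00:38Z · AUTO-CRUX (backfill): EventualTight — hypotheses of the deciding theorem that nothing in the route derives are cruxes (operator:999:1085951)
- 2026-08-26T04:21:24Z · DORMANT — reconciler: no traction for 8.3 d (last activity item-evidence-added at 2026-08-17T19:24:59Z); parked, not closed — `ledger route dormant route-CriticalPhenomen (operator:999:2244387)

sub-problem: SAWScalingLimit · status: dormant · opened planner-plancard-CriticalPhenomena-SAWScaling-e526a949-0 2026-08-15T11:34:54Z · rev 5 · ledger route-CriticalPhenomena-SAWRenewalTightness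
GENERATED by the gate from the ledger (D-0016/17). Provers cite these decls: `theorem foo : Summit.CriticalPhenomena.SAWScalingLimit.Theses.SAWRenewalTightness.<Decl> := …` in Summits/CriticalPhenomena/SAWScalingLimit/Theorems/<Name>.lean.
-/

namespace Summit.CriticalPhenomena.SAWScalingLimit.Theses.SAWRenewalTightness

open scoped BigOperators Topology Manifold Classical MeasureTheory ProbabilityTheory Matrix InnerProductSpace ComplexConjugate ContinuousMap
open Filter Set Function TopologicalSpace MeasureTheory

attribute [summit_statement] _root_.SAWScalingLimit

/-- item stmt-CriticalPhenomena-1372 · crux (kind.auto-crux: conjecture-grade) · rank 0 · SPLIT (gen 1) into ConfinementPositivity, BulkShellTight + glue EventualTightOfSubs · direct attempts still welcome (low priority) · by planner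
why it might fail: Needs an Aizenman–Burchard/KS crossing bound for x_c-SAW that is proved on no lattice (KS17 §4 omits SAW); true if the conjunct is (a converging family of lattice polylines is eventually tight), so a refutation would kill the conjunct itself.
sources: KemppainenSmirnov2017, AizenmanBurchardDuke1999, Summit.CriticalPhenomena.SAWScalingLimit.Theorems.SAWParafermionTight_refuted, DuminilCopinHammond2013
[support] eventual tightness of the pushed-forward critical SAW laws: for every Dobrushin domain and
endpoint approximation there is δ₀ > 0 such that {(law D δ a_δ b_δ).map curve : δ ∈ (0, δ₀]} is a
tight set of measures on CurveClass ℂ — the repaired (∃ δ₀) form of the refuted all-δ statement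
stmt-CriticalPhenomena-0772 suggested by its refutation; child-designate of LimitExists, shared need
of every SAW route. Intended tools: Aizenman–Burchard / Kemppainen–Smirnov Condition G2 (an
annulus-crossing bound at x_c not in print). Sources: KemppainenSmirnov2017 Thm 1.5,
AizenmanBurchardDuke1999, DuminilCopinHammond2013. -/
@[route_item "route-CriticalPhenomena-SAWRenewalTightness", crux]
def EventualTight : Prop :=
  ∀ (D : Literature.Probability.RandomPlanarGeometry.DobrushinDomain) (a b : ℝ → Literature.Probability.LatticeModels.Site 2), Literature.Probability.RandomPlanarGeometry.SAW.IsEndpointApprox D a b → ∃ δ₀ : ℝ, 0 < δ₀ ∧ MeasureTheory.IsTightMeasureSet ((fun δ => (Literature.Probability.RandomPlanarGeometry.SAW.law D.carrier δ (a δ) (b δ)).map (fun γ => γ.curve)) '' Set.Ioc 0 δ₀)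

-- parent: EventualTight · child (gen 1)
/--     item stmt-CriticalPhenomena-17587 · crux · rank 1 · open
    parent: EventualTight · by operator
    why it might fail: RSW-type LOWER bound for x_c-SAW proved on no lattice (no FKG/duality); absolute bounds give only e^{-C/δ} ≤ Z_{D'}/Z_D (Hammersley–Welsh vs one path); the PA substitute (SAWLeftRightFKG) is blocked on CriticalBubbleBound stmt-7117.
    sources: LawlerSchrammWerner2004SAW, KemppainenSmirnov2017, DuminilCopinHammond2013, MadrasSlade1993, arXiv:1707.09335
[crux] restriction positivity (the SAW box-crossing property): for nested Dobrushin domains D' ⊆ D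
with the same marked points and sockets D ∩ (B(a,d) ∪ B(b,d)) ⊆ D', and every endpoint approximation
of D', the critical SAW of D_δ from a_δ to b_δ is a D'_δ-walk with probability ≥ c > 0 for all δ ∈
(0, δ₀]. Equivalent to liminf_δ Z_{D'}(a_δ,b_δ)/Z_D(a_δ,b_δ) > 0
(Theorems.confinementPositivity_iff_partitionRatio, p103341); implied by SAWScalingLimit
(Theorems.confinementPositivity_of_scalingLimit, p105757), so summit-safe; monotone in nested
quadruples (Theorems.confinementRatio_mono, p139226), hence reducible to standard pairs (tube inside
an enlargement). Verbatim the registered stub stub_confinementPositivity of lines Sketch v5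
(stmt-1372) and confinement-bulk-tightness (stmt-4728). Numerics: Z_{D'}/Z_D ≈ 0.6–0.7 flat in δ
(PERM j012789, Cruxes/ShellCrossingBound/ToyDataIdeator2.md). -/
@[route_item "route-CriticalPhenomena-SAWRenewalTightness", crux]
def ConfinementPositivity : Prop :=
  ∀ (D D' : Literature.Probability.RandomPlanarGeometry.DobrushinDomain) (a b : ℝ → Literature.Probability.LatticeModels.Site 2) (d : ℝ), 0 < d → D'.carrier ⊆ D.carrier → D'.pt 0 = D.pt 0 → D'.pt 1 = D.pt 1 → D.carrier ∩ (Metric.ball (D.pt 0) d ∪ Metric.ball (D.pt 1) d) ⊆ D'.carrier → Literature.Probability.RandomPlanarGeometry.SAW.IsEndpointApprox D' a b → ∃ c δ₀ : ℝ, 0 < c ∧ 0 < δ₀ ∧ ∀ δ ∈ Set.Ioc (0 : ℝ) δ₀, ENNReal.ofReal c ≤ Literature.Probability.RandomPlanarGeometry.SAW.law D.carrier δ (a δ) (b δ) {γ | ∃ γ' : Literature.Probability.RandomPlanarGeometry.SAW.DomainSAW D'.carrier δ (a δ) (b δ), γ'.walk.support = γ.walk.support}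

-- parent: EventualTight · child (gen 1)
/--     item stmt-CriticalPhenomena-17588 · crux · rank 2 · open
    parent: EventualTight · by operator
    why it might fail: Bulk multi-strand non-degeneracy of critical Z² SAW: needs a δ-uniform bound on a two-pinned ratio (no BK for strands of one walk; G_{x_c}(0,x)<∞ open in d=2; sup-over-past forms refuted as typed; fixed-resolution surgery dead). False only if SAWScalingLimit is.
    sources: AizenmanBurchardDuke1999, KemppainenSmirnov2017, MadrasSlade1993, DuminilCopinHammond2013, arXiv:1305.1257, arXiv:2310.17299
[crux] per-shell tightness of the traversal count on INTERIOR shells: for every Dobrushin domain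
with an endpoint approximation, every shell D(y; η, R) with 0 < η < R and closedBall y (2R) ⊆ Ω, and
every ε > 0, some threshold j and mesh bound δ₁ > 0 give P_δ[the SAW polyline makes j separate
traversals of D(y; η, R)] ≤ ε for δ ∈ (0, δ₁]. No fixed threshold, no rate (the weakest usable form:
a rate at fixed threshold is the dead 4-arm statement PinchAwayAll). Implied by the crux
(Lines/Sketch.lean bulkShellTight_of_eventualTight), hence by SAWScalingLimit (TightnessNecessary):
summit-safe. Equivalent, given the landed Confinement (p85927), to the registered stub
stub_bulkCleanMultiShadowDecay (shadow normal form, p138401 + Sketch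
bulkCleanMultiShadowDecay_of_bulkShellTight); reduces by exact two-sided domain-Markov virginization
to the pure-lattice, exterior-uniform atom X2/X2c (Cruxes/EventualTight/X2VirginDiscZ2.lean,
MERGE-c3 §5). Numerics consistent (BFACF j016511–j016514: P_16(N ≥ 8) = 0 on the centre aspect-2
shell). -/
@[route_item "route-CriticalPhenomena-SAWRenewalTightness", crux]
def BulkShellTight : Prop :=
  ∀ (D : Literature.Probability.RandomPlanarGeometry.DobrushinDomain) (a b : ℝ → Literature.Probability.LatticeModels.Site 2), Literature.Probability.RandomPlanarGeometry.SAW.IsEndpointApprox D a b → ∀ (y : ℂ) (η R : ℝ), 0 < η → η < R → Metric.closedBall y (2 * R) ⊆ D.carrier → ∀ ε : ℝ, 0 < ε → ∃ (j : ℕ) (δ₁ : ℝ), 0 < δ₁ ∧ ∀ δ ∈ Set.Ioc (0 : ℝ) δ₁, Literature.Probability.RandomPlanarGeometry.SAW.law D.carrier δ (a δ) (b δ) {γ | (⟨γ.walk.toCurve (Literature.Probability.LatticeModels.meshPoint δ)⟩ : Literature.Probability.RandomPlanarGeometry.Curve ℂ).HasTraversals j y η R} ≤ ENNReal.ofReal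 ε

-- parent: EventualTight · glue (gen 1)
/--     item stmt-CriticalPhenomena-17589 · support · rank 3 · closed · proved by Summit.CriticalPhenomena.SAWScalingLimit.Theorems.EventualTightOfSubs_proof @ 277bedaca059 (prover)
    parent: EventualTight · GLUE: children ⟹ parent · by operator
EventualTight_of_subs : ConfinementPositivity → BulkShellTight → EventualTight — the composition
TightOfShellCrossing_proof ∘ Theorems.ShellCrossingBound_of_subs (p138355) of two LANDED theorems;
kernel-checked file attached as evidence SAWRenewalTightnessEventualTightSplit.lean on
stmt-CriticalPhenomena-1372 (registered stub EventualTight_of_subs), to be landed verbatim by a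
prover as Theorems/SAWRenewalTightnessEventualTightSplit.lean -/
@[route_item "route-CriticalPhenomena-SAWRenewalTightness"]
def EventualTightOfSubs : Prop :=
  ConfinementPositivity → BulkShellTight → EventualTight

-- `EventualTightOfSubs` holds: proved by `Summit.CriticalPhenomena.SAWScalingLimit.Theorems.EventualTightOfSubs_proof` @ 277bedaca059 (its module imports this route file, so no `_holds` link can be stated here).

/-- item stmt-CriticalPhenomena-4728 · crux · rank 2 · open · by planner
why it might fail: Uniformity down to ρ = δ and up to ∂Ω with λ > 2: no a-priori arm bound for x_c-SAW exists on any lattice (KS17 §4 omits SAW; hex has only bridge decay); near wild Jordan boundaries forced traversals are unbounded over shells (k shell-dependent absorbs this only if finite per shell uniformly in δ).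
sources: AizenmanBurchardDuke1999, KemppainenSmirnov2017, DuminilCopinHammond2013, arXiv:2310.17299, Literature.Probability.RandomPlanarGeometry.isTightMeasureSet_of_traversalBounds
[crux] (card E3 output; Aizenman–Burchard (H1) for the SAW) for every Dobrushin domain D and
endpoint approximation (a_δ,b_δ) there are a shell-dependent threshold k : ℂ → ℝ → ℝ → ℕ, constants
K, λ > 2 and δ₀ > 0 such that for all δ ∈ (0,δ₀], all x ∈ ℂ and δ ≤ ρ < R ≤ 1: P_δ[the SAW polyline
traverses the shell D(x; ρ, R) by k(x,ρ,R) separate segments] ≤ K (ρ/R)^λ (Curve.HasTraversals of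
CurveTortuosity.lean). k may depend on the shell because ∂Ω (fjords, oscillating corridors near a)
can force any fixed finite number of traversals deterministically — exactly the freedom the in-tree
criterion isTightMeasureSet_of_traversalBounds allows. [deps: AnnularMassDecay, TubeLowerBound]
[difficulty: open-problem] -/
@[route_item "route-CriticalPhenomena-SAWRenewalTightness"]
def ShellCrossingBound : Prop :=
  ∀ (D : Literature.Probability.RandomPlanarGeometry.DobrushinDomain) (a b : ℝ → Literature.Probability.LatticeModels.Site 2), Literature.Probability.RandomPlanarGeometry.SAW.IsEndpointApprox D a b → ∃ (k : ℂ → ℝ → ℝ → ℕ) (K lam δ₀ : ℝ), 2 < lam ∧ 0 < δ₀ ∧ ∀ δ ∈ Set.Ioc (0 : ℝ) δ₀, ∀ (x : ℂ) (ρ R : ℝ), δ ≤ ρ → ρ < R → R ≤ 1 → Literature.Probability.RandomPlanarGeometry.SAW.law D.carrier δ (a δ) (b δ) {γ | (⟨γ.walk.toCurve (Literature.Probability.LatticeModels.meshPoint δ)⟩ : Literature.Probability.RandomPlanarGeometry.Curve ℂ).HasTraversals (k x ρ R) x ρ R} ≤ ENNReal.ofReal (K * (ρ / R) ^ lam)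

/-- item stmt-CriticalPhenomena-19311 · crux · rank 3 · open · by planner
why it might fail: KS Condition-G2 content at BOUNDARY annuli for x_c-SAW: no boundary RSW (no FKG), no Z² observable; fjord-comb Jordan domains make unforced re-entries ratios of finite-volume critical 2-pt functions, controlled nowhere in print (KS17 SAW unverified; DKY14 Prob.10). False only if LSW is.
sources: KemppainenSmirnov2017, AizenmanBurchardDuke1999, DuminilCopinKozmaYadin2014, MadrasSlade1993, paper:galaxy-pdf-976184500
[crux] per-shell tightness of the traversal count on FRONTIER-CENTRED shells: for every Dobrushin
domain (D; a, b) with an endpoint approximation, every x ∈ ∂D, 0 < ρ, 4ρ ≤ R ≤ 1 and ε > 0 there are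
k and δ₀ > 0 (depending on the shell) with P_δ[≥ k separate traversals of D(x; ρ, R)] ≤ ε for δ ∈
(0, δ₀]. By name = Theorems.TPToTraversalBound.Radial.BoundaryShellTight (route SAWTotalPositivity,
crux stmt-10687, line radial-portal-transfer rev 4 stub 5′). Implied by the crux
(Theorems.boundaryShellTight_of_eventualTight) and by SAWScalingLimit
(Theorems.boundaryShellTight_of_sawScalingLimit, p172517): summit-safe. With BulkShellTight it is
EXACTLY the crux: Theorems.eventualTight_iff_bulkShellTight_and_boundaryShellTight (p172517) —
E-free (no ConfinementPositivity, no domain enlargement). Registered stub stub_boundaryShellTight of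
line Lines/boundary_bulk.lean. The Jordan loop is load-bearing here and only here (Disproof §5
eventualTight_false_without_jordan). Why it might fail: KS Condition-G2 content AT BOUNDARY annuli
for the x_c-SAW: no boundary RSW (no FKG), no Z² observable; in fjord-comb Jordan domains unforced
re-entries are ratios of finite-volume critical two-point functio -/
@[route_item "route-CriticalPhenomena-SAWRenewalTightness"]
def BoundaryShellTight : Prop :=
  ∀ (D : Literature.Probability.RandomPlanarGeometry.DobrushinDomain) (a b : ℝ → Literature.Probability.LatticeModels.Site 2), Literature.Probability.RandomPlanarGeometry.SAW.IsEndpointApprox D a b → ∀ (x : ℂ) (ρ R : ℝ), x ∈ frontier D.carrier → 0 < ρ → 4 * ρ ≤ R → R ≤ 1 → ∀ ε : ℝ, 0 < ε → ∃ (k : ℕ) (δ₀ : ℝ), 0 < δ₀ ∧ ∀ δ ∈ Set.Ioc (0 : ℝ) δ₀, Literature.Probability.RandomPlanarGeometry.SAW.law D.carrier δ (a δ) (b δ) {γ | (⟨γ.walk.toCurve (Literature.Probability.LatticeModels.meshPoint δ)⟩ : Literature.Probability.RandomPlanarGeometry.Curve ℂ).HasTraversals k x ρ R} ≤ ENNReal.ofReal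 ε

/-- item stmt-CriticalPhenomena-4729 · crux · rank 3 · SPLIT (gen 1) into TransversalDelocalization, IrreduciblePrefixOneArm + glue AnnularMassDecayOfSubs · direct attempts still welcome (low priority) · by planner
why it might fail: Curvature kills the exact renewal decomposition; θ>0 is a radial form of 'bridge partition function of height T → 0 polynomially at x_c', open on ℤ² (MadrasSlade1993 p.92 'believed, no known proof'; arXiv:2310.17299 p.2 'a major obstacle'; hex only, via parafermion). Even θ=0 is unproved.
sources: Kesten1963SAW, MadrasSlade1993 §4.2 (4.2.4) and Cor. 3.1.8 and p.92, arXiv:2310.17299 p.2 and Thm 2 (hexagonal bridge decay), arXiv:1109.0358, GlazmanManolescu2019 Thm 2, LawlerSchrammWerner2004SAW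
[crux] (card E1, SAW-RSW upper bound = annular mass conservation; lattice units on ℤ², scale-free)
there are θ > 0 and C such that for every centre z ∈ ℂ, radii 1 ≤ r < R and start vertex u with |u −
z| ≥ R, the x_c-mass Σ x_c^{|ω|} over self-avoiding walks ω from u whose interior vertices lie in
the open annulus r < |· − z| < R and whose last vertex lies in |· − z| ≤ r ("annular bridges": the
radius is maximal at the start and minimal at the end, the exact analogue of Kesten's bridges, which
in a straight strip have x_c-mass u_L ≤ 1 by Σ_irr x_c^|β| = 1) is ≤ C (r/R)^θ (all partial sums;
x_c = SAW.criticalFugacity). [deps: KestenIdentity, StripMassConservation] [difficulty: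
open-problem] -/
@[route_item "route-CriticalPhenomena-SAWRenewalTightness"]
def AnnularMassDecay : Prop :=
  ∃ θ C : ℝ, 0 < θ ∧ ∀ (z : ℂ) (r R : ℝ), 1 ≤ r → r < R → ∀ (u : Literature.Probability.LatticeModels.Site 2), R ≤ dist (Literature.Probability.LatticeModels.Site.toComplex u) z → ∀ N : ℕ, (∑ n ∈ Finset.range (N + 1), ∑ _ω ∈ (Literature.Probability.RandomPlanarGeometry.SAW.Zd.saws 2 n).filter (fun ω => (∀ i, 0 < i → i < n → r < dist (Literature.Probability.LatticeModels.Site.toComplex (u + ω i)) z ∧ dist (Literature.Probability.LatticeModels.Site.toComplex (u + ω i)) z < R) ∧ dist (Literature.Probability.LatticeModels.Site.toComplex (u + ω n)) z ≤ r), Literature.Probability.RandomPlanarGeometry.SAW.criticalFugacity ^ n) ≤ C * (r / R) ^ θ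

-- parent: AnnularMassDecay · child (gen 1)
/--     item stmt-CriticalPhenomena-18018 · crux · rank 301 · open
    parent: AnnularMassDecay · by operator
    why it might fail: Rate (ρ/t)^a needs renewal abundance + transversal non-degeneracy of large irreducible pieces at every scale (lower bounds at x_c, none in print); for generic irrational e no symmetry (z-renewal flip / future reflection only for axis, diagonal e); thin-window form was false.
    sources: arXiv:1008.4321, arXiv:1305.1257, arXiv:1205.0401, Kesten1963SAW, MadrasSlade1993
[crux] (child 1 of the split of AnnularMassDecay along the landed last-renewal reduction p150323; =
registered stub S3 `stub_transversalDelocalization`, repaired thick-window form, of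
Cruxes/AnnularMassDecay/Lines/last_renewal_delocalization.lean, spelled over Literature vocabulary
with local abbreviations h u' y = e-height ⟨y−u',e⟩, b u' x' M = x_c-mass of e-bridges u'→u'+x' of
length ≤ M, p t' M = x_c-mass of irreducible e-bridges from 0 of length ≤ M and span ≥ t'; `Iff`
with the vocabulary form ht/brMass/irrTail: evidence SAWRenewalTightnessAnnularMassDecaySplit.lean,
transversalDelocalization_iff) TRANSVERSAL DELOCALISATION OF THE LAST RENEWAL POINT BELOW A LEVEL,
relative form: there are a > 0, C₁ > 0 such that for every real unit direction e, start u, ball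
centre c, radii/levels 1 ≤ ρ ≤ t with t + ρ ≤ ℓ (height window at least as thick as the ball),
finite offset set S and truncations N, N' there are N'', N''' with Σ_{x∈S: |u+x−c|<ρ, t≤h(u+x)<ℓ}
b_N(u→u+x)·p̄_{N'}(ℓ−h(u+x)) ≤ C₁(ρ/t)^a · Σ_{x∈box N'': t≤h(u+x)<ℓ} b_{N''}·p̄_{N'''}. Meaning
(Kesten's renewal measure P_K in direction e, i.i.d. irreducible pieces, b·p̄(ℓ−h) = P_K(V = v) for
V the last renewal point strictly bel -/
@[route_item "route-CriticalPhenomena-SAWRenewalTightness"]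
def TransversalDelocalization : Prop :=
  ∃ a C₁ : ℝ, 0 < a ∧ 0 < C₁ ∧ ∀ (e : ℂ), ‖e‖ = 1 → ∀ (h : Literature.Probability.LatticeModels.Site 2 → Literature.Probability.LatticeModels.Site 2 → ℝ), h = (fun u' y => ((Literature.Probability.LatticeModels.Site.toComplex y - Literature.Probability.LatticeModels.Site.toComplex u') * (starRingEnd ℂ) e).re) → ∀ (b : Literature.Probability.LatticeModels.Site 2 → Literature.Probability.LatticeModels.Site 2 → ℕ → ℝ), b = (fun u' x' M => ∑ m ∈ Finset.range (M + 1), ∑ _β ∈ (Literature.Probability.RandomPlanarGeometry.SAW.Zd.saws 2 m).filter (fun β => ((∀ i, 1 ≤ i → i ≤ m → 0 < h u' (u' + β i)) ∧ (∀ i, i ≤ m → h u' (u' + β i) ≤ h u' (u' + β m))) ∧ β m = x'), Literature.Probability.RandomPlanarGeometry.SAW.criticalFugacity ^ m) → ∀ (p : ℝ → ℕ → ℝ), p = (fun t' M => ∑ m ∈ Finset.range (M + 1), ∑ _β ∈ (Literature.Probability.RandomPlanarGeometry.SAW.Zd.saws 2 m).filter (fun β => (0 < m ∧ ((∀ i,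 1 ≤ i → i ≤ m → 0 < h 0 (0 + β i)) ∧ (∀ i, i ≤ m → h 0 (0 + β i) ≤ h 0 (0 + β m))) ∧ ∀ s, 1 ≤ s → s < m → ¬ ((∀ i, i < s → h 0 (0 + β i) ≤ h 0 (0 + β s)) ∧ (∀ j, s < j → j ≤ m → h 0 (0 + β s) < h 0 (0 + β j)))) ∧ t' ≤ h 0 (β m)), Literature.Probability.RandomPlanarGeometry.SAW.criticalFugacity ^ m) → ∀ (u : Literature.Probability.LatticeModels.Site 2) (c : ℂ) (ρ t ℓ : ℝ), 1 ≤ ρ → ρ ≤ t → t + ρ ≤ ℓ → ∀ (S : Finset (Literature.Probability.LatticeModels.Site 2)) (N N' : ℕ), ∃ N'' N''' : ℕ, (∑ x ∈ S.filter (fun x => dist (Literature.Probability.LatticeModels.Site.toComplex (u + x)) c < ρ ∧ t ≤ h u (u + x) ∧ h u (u + x) < ℓ), b u x N * p (ℓ - h u (u + x)) N') ≤ C₁ * (ρ / t) ^ a * ∑ x ∈ ((Literature.Probability.LatticeModels.box 2 N'').filter (fun x => t ≤ h u (u + x))).filter (fun x => h u (u + x) < ℓ), b u x N'' * p (ℓ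 - h u (u + x)) N'''

-- parent: AnnularMassDecay · child (gen 1)
/--     item stmt-CriticalPhenomena-18019 · crux · rank 302 · open
    parent: AnnularMassDecay · by operator
    why it might fail: Contains the θ=0 bounded-aspect atom (uniform bound for a restricted critical 2-point mass on ℤ², MS93 p.77) + un-weighting of trapped/overshooting prefixes vs p̄ + aiming (r/d)^θ₂ uniform in irrational e; no engine in print (KP23 p.2); false if prefix/completion ratio grows faster than (d/r)^(2/3).
    sources: arXiv:1008.4321, arXiv:1205.0401, MadrasSlade1993, arXiv:2310.17299, LawlerSchrammWerner2004SAW, Kesten1963SAW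
[crux] (child 2, HARDEST — the crux's core; = registered stub S4 `stub_irreduciblePrefixOneArm` of
Lines/last_renewal_delocalization.lean over Literature vocabulary with local abbreviations e =
(z−u)/|z−u| (crux frame), ℓ = |z−u| − r (level of the disc bottom), h u' y = e-height, p =
irreducible span tail; `Iff` with the vocabulary form pfxMass/irrTail/frameDir/botLevel: evidence
SAWRenewalTightnessAnnularMassDecaySplit.lean, irreduciblePrefixOneArm_iff) IRREDUCIBLE-PREFIX
ONE-ARM: there are θ₂ > 0, C₂ > 0 such that for every centre z, radii 1 ≤ r < R, start u with |u−z|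
≥ R and every N there is N' with, for every offset x (v := u+x): N°_N(v) ≤ C₂·p̄_{N'}(ℓ −
h(v))·(r/|v−z|)^{θ₂}, where N°_N(v) is the x_c-mass of LAST EXCURSIONS — walks of length ≤ N from v
with h(v) < ℓ, living strictly above h(v), with no e-renewal time at a height < ℓ, interior vertices
in the open annulus r < |·−z| < R, endpoint in |·−z| ≤ r. Meaning: the walk after the last renewal
below the disc level is a prefix of ONE irreducible piece of span ≥ ℓ − h(v) (cost p̄, exactly what
the straddling identity S2 consumes) aimed at an r-disc at distance |v−z| (cost (r/d)^{θ₂});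
un-weighting prefix vs completed piece -/
@[route_item "route-CriticalPhenomena-SAWRenewalTightness"]
def IrreduciblePrefixOneArm : Prop :=
  ∃ θ₂ C₂ : ℝ, 0 < θ₂ ∧ 0 < C₂ ∧ ∀ (z : ℂ) (r R : ℝ), 1 ≤ r → r < R → ∀ (u : Literature.Probability.LatticeModels.Site 2), R ≤ dist (Literature.Probability.LatticeModels.Site.toComplex u) z → ∀ (e : ℂ), e = (z - Literature.Probability.LatticeModels.Site.toComplex u) / ((dist (Literature.Probability.LatticeModels.Site.toComplex u) z : ℝ) : ℂ) → ∀ (ℓ : ℝ), ℓ = dist (Literature.Probability.LatticeModels.Site.toComplex u) z - r → ∀ (h : Literature.Probability.LatticeModels.Site 2 → Literature.Probability.LatticeModels.Site 2 → ℝ), h = (fun u' y => ((Literature.Probability.LatticeModels.Site.toComplex y - Literature.Probability.LatticeModels.Site.toComplex u') * (starRingEnd ℂ) e).re) → ∀ (p : ℝ → ℕ → ℝ), p = (fun t' M => ∑ m ∈ Finset.range (M + 1), ∑ _β ∈ (Literature.Probability.RandomPlanarGeometry.SAW.Zd.saws 2 m).filter (fun β => (0 < m ∧ ((∀ i, 1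 ≤ i → i ≤ m → 0 < h 0 (0 + β i)) ∧ (∀ i, i ≤ m → h 0 (0 + β i) ≤ h 0 (0 + β m))) ∧ ∀ s, 1 ≤ s → s < m → ¬ ((∀ i, i < s → h 0 (0 + β i) ≤ h 0 (0 + β s)) ∧ (∀ j, s < j → j ≤ m → h 0 (0 + β s) < h 0 (0 + β j)))) ∧ t' ≤ h 0 (β m)), Literature.Probability.RandomPlanarGeometry.SAW.criticalFugacity ^ m) → ∀ N : ℕ, ∃ N' : ℕ, ∀ x : Literature.Probability.LatticeModels.Site 2, (∑ m ∈ Finset.range (N + 1), ∑ _η ∈ (Literature.Probability.RandomPlanarGeometry.SAW.Zd.saws 2 m).filter (fun η => h u (u + x) < ℓ ∧ (∀ s, 1 ≤ s → s ≤ m → h u (u + x) < h u (u + x + η s)) ∧ (∀ s, 1 ≤ s → s ≤ m → h u (u + x + η s) < ℓ → ¬ ((∀ i, i < s → h u (u + x + η i) ≤ h u (u + x + η s)) ∧ (∀ j, s < j → j ≤ m → h u (u + x + η s) < h u (u + x + η j)))) ∧ (∀ s, 1 ≤ s → s < m → r < dist (Literature.Probability.LatticeModels.Site.toComplex (u + x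 + η s)) z ∧ dist (Literature.Probability.LatticeModels.Site.toComplex (u + x + η s)) z < R) ∧ dist (Literature.Probability.LatticeModels.Site.toComplex (u + x + η m)) z ≤ r), Literature.Probability.RandomPlanarGeometry.SAW.criticalFugacity ^ m) ≤ C₂ * p (ℓ - h u (u + x)) N' * (r / dist (Literature.Probability.LatticeModels.Site.toComplex (u + x)) z) ^ θ₂

-- parent: AnnularMassDecay · glue (gen 1)
/--     item stmt-CriticalPhenomena-18020 · support · rank 303 · open
    parent: AnnularMassDecay · GLUE: children ⟹ parent · by operator
AnnularMassDecayOfSubs : TransversalDelocalization → IrreduciblePrefixOneArm → AnnularMassDecay —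
the kernel-checked last-renewal reduction of the line last-renewal-delocalization (S1 decoupling
p141438 + S2 straddling-piece identity p145503/p146866/p148970 + two-regime bound, assembled as
Theorems…LastRenewalReduction.lr_annularMassDecay_of_open_stubs p150323); one-line proof modulo
unfolding the children's local abbreviations, kernel-checked in the strategist's SplitScratch.lean
and attached as evidence SAWRenewalTightnessAnnularMassDecaySplit.lean
(AnnularMassDecayOfSubs_proof) for a prover to land verbatim -/
@[route_item "route-CriticalPhenomena-SAWRenewalTightness"]
def AnnularMassDecayOfSubs : Prop :=
  TransversalDelocalization → IrreduciblePrefixOneArm → AnnularMassDecay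

/-- item stmt-CriticalPhenomena-4730 · crux · rank 4 · open · by planner
why it might fail: Only exponential-scale lower bounds are classical (μ^n e^-c√n ≤ b_n; Σ_L≤Λ u_L ≳ ½log Λ from MS (3.1.14)); a POINTWISE polynomial lower bound for point-to-point x_c-masses, let alone inside a tube of fixed aspect ratio, is not in print for ℤ².
sources: MadrasSlade1993 Cor. 3.1.6 and (3.1.14), DuminilCopinHammond2013, arXiv:1305.1257, arXiv:1809.00760
[crux] (card E2, SAW-RSW lower bound) there are C and c > 0 such that for all vertices u, v of ℤ²
and ℓ ≥ 1 with |u − v| ≤ ℓ, the x_c-mass of self-avoiding walks from u to v all of whose vertices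
stay within distance ℓ/10 + 2 of the segment [u, v] is ≥ c ℓ^{−C} (some partial sum already exceeds
the bound). Implies the card's obstacle form (K at distance ≥ ℓ/10 from [u,v] is not met) and is
what the surgery needs to re-glue a walk after excising an annular excursion. [deps: KestenIdentity]
[difficulty: L] -/
@[route_item "route-CriticalPhenomena-SAWRenewalTightness"]
def TubeLowerBound : Prop :=
  ∃ C c : ℝ, 0 < c ∧ ∀ (u v : Literature.Probability.LatticeModels.Site 2) (ℓ : ℝ), 1 ≤ ℓ → dist (Literature.Probability.LatticeModels.Site.toComplex u) (Literature.Probability.LatticeModels.Site.toComplex v) ≤ ℓ → ∃ N : ℕ, c * ℓ ^ (-C) ≤ ∑ n ∈ Finset.range (N + 1), ∑ _ω ∈ (Literature.Probability.RandomPlanarGeometry.SAW.Zd.sawFun 2 n (v - u)).filter (fun ω => ∀ i ≤ n, Metric.infDist (Literature.Probability.LatticeModels.Site.toComplex (u + ω i)) (segment ℝ (Literature.Probability.LatticeModels.Site.toComplex u) (Literature.Probability.LatticeModels.Site.toComplex v)) ≤ ℓ / 10 + 2), Literature.Probability.RandomPlanarGeometry.SAW.criticalFugacity ^ n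

/-- item stmt-CriticalPhenomena-0783 · crux · rank 5 · open · by planner
why it might fail: Unconditional over arbitrary subsequential μ: print gives SLE_8/3 only IF the limit is conformally covariant (LSW04 Prediction 1); on ℤ² no observable; embedding-blind inputs cannot produce rotation covariance (EmbeddingModulusUniqueness).
sources: LawlerSchrammWerner2004SAW, LawlerSchrammWerner2003Restriction, DuminilCopinSmirnov2012, Literature.Barriers.CriticalPhenomena.EmbeddingModulusUniqueness
[crux] r3: identification of subsequential limits — for every Dobrushin domain D, endpoint
approximation (a_δ,b_δ), sequence s_n → 0+ and probability measure μ on CurveClass ℂ, if ∫ f∘curve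
d(Literature.Probability.RandomPlanarGeometry.SAW.law D (s n) …) → ∫ f dμ for all bounded continuous
f then μ is the chordal SLE_{8/3} law in D (Literature.Probability.RandomPlanarGeometry.IsSLELaw
(8/3) D μ). Obtained from r2 (observable limit) by the martingale principle (LSW03
arXiv:math/0209343 Prop. 5.2: κ = 8/3 is singled out by the 5/8-observable), or from restriction
(sibling route). -/
@[route_item "route-CriticalPhenomena-SAWRenewalTightness", crux]
def SubseqIdentification : Prop :=
  ∀ (D : Literature.Probability.RandomPlanarGeometry.DobrushinDomain) (a b : ℝ → Literature.Probability.LatticeModels.Site 2), Literature.Probability.RandomPlanarGeometry.SAW.IsEndpointApprox D a b → ∀ (s : ℕ → ℝ) (μ : MeasureTheory.Measure (Literature.Probability.RandomPlanarGeometry.CurveClass ℂ)), Filter.Tendsto s Filter.atTop (nhdsWithin 0 (Set.Ioi 0)) → MeasureTheory.IsProbabilityMeasure μ → (∀ f : BoundedContinuousFunction (Literature.Probability.RandomPlanarGeometry.CurveClass ℂ) ℝ, Filter.Tendsto (fun n => ∫ γ, f γ.curve ∂(Literature.Probability.RandomPlanarGeometry.SAW.law D.carrier (s n) (a (s n)) (b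 (s n)))) Filter.atTop (nhds (∫ x, f x ∂μ))) → Literature.Probability.RandomPlanarGeometry.IsSLELaw ((8 : NNReal) / 3) D μ

/-- item stmt-CriticalPhenomena-17749 · support · rank 9 · closed · proved by Summit.CriticalPhenomena.SAWScalingLimit.Theorems.ShellCrossingBoundOfSubs_proof (prover) · by planner
sources: AizenmanBurchardDuke1999, LawlerSchrammWerner2004SAW, Summit.CriticalPhenomena.SAWScalingLimit.Theorems.ShellCrossingBound_of_subs
[support] glue (route-repair 2026-08-17, unused-crux BulkShellTight): ConfinementPositivity →
BulkShellTight → ShellCrossingBound — verbatim the LANDED theorem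
Theorems.ShellCrossingBound_of_subs (Theorems/SAWRenewalTightnessShellCrossingBoundSplit.lean,
p138355; its two hypotheses are definitionally the bodies of the gen-1 children of EventualTight),
hence provable now in one line `fun hC hB => Theorems.ShellCrossingBound_of_subs hC hB` (planner
Sketch.lean, lean check rc 0). It records the actual dependency of the strategist's split: the
children feed ShellCrossingBound (r2), which feeds the closes hypothesis EventualTight through the
PROVED item TightOfShellCrossing (stmt-CriticalPhenomena-4732); the split glue EventualTightOfSubs
(stmt-CriticalPhenomena-17589) is the composite TightOfShellCrossing_proof ∘
ShellCrossingBound_of_subs. The deciding theorem cannot consume the children directly while it lives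
in the Theses file (both glue proofs are Theorems modules importing this file — cyclic import), so
the kernel cone of `closes` lists split children as unused by construction; the item-implication
chain BulkShellTight → ShellCrossingBound → EventualTight → closes is the connecti -/
@[route_item "route-CriticalPhenomena-SAWRenewalTightness"]
def ShellCrossingBoundOfSubs : Prop :=
  ConfinementPositivity → BulkShellTight → ShellCrossingBound

-- `ShellCrossingBoundOfSubs` holds: proved by `Summit.CriticalPhenomena.SAWScalingLimit.Theorems.ShellCrossingBoundOfSubs_proof` (its module imports this route file, so no `_holds` link can be stated here).

/-- item stmt-CriticalPhenomena-4731 · support · rank 9 · open · by planner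
sources: Kesten1987, DuminilCopinHammond2013, arXiv:1305.1257, arXiv:1504.05286, AizenmanBurchardDuke1999
[support] (card E3, the foreseen glue of the split r2 ⇐ r3, r4) AnnularMassDecay → TubeLowerBound →
ShellCrossingBound: a k-fold traversal of D(x;ρ,R) by the SAW in Ω_δ contains k disjoint annular
bridges alternating in direction; excise an in–out pair, re-glue through a tube connector
(TubeLowerBound pays ℓ^-C), and bound the multiplicity of the multi-valued map by the x_c-mass of
the excised double excursion (AnnularMassDecay pays (ρ/R)^θ per pair, uniformly in the slit domain
by monotonicity in the domain); iterate: λ_k ≥ cθk − C′, choose k with λ_k > 2. Filed as support so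
that anyone may attempt it; it becomes the glue item of `route edit --split ShellCrossingBound
--into AnnularMassDecay TubeLowerBound` once r3 or r4 has traction. [difficulty: XL] -/
@[route_item "route-CriticalPhenomena-SAWRenewalTightness"]
def SurgeryReduction : Prop :=
  AnnularMassDecay → TubeLowerBound → ShellCrossingBound

/-- item stmt-CriticalPhenomena-4732 · support · rank 9 · closed · proved by Summit.CriticalPhenomena.SAWScalingLimit.Theorems.TightOfShellCrossing_proof (prover) · by planner
sources: AizenmanBurchardDuke1999, Literature.Probability.RandomPlanarGeometry.isTightMeasureSet_of_traversalBounds, Literature.Probability.RandomPlanarGeometry.exists_finset_card_le_cover_closedBall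
[support] ShellCrossingBound → EventualTight, by the PROVED Aizenman–Burchard criterion
isTightMeasureSet_of_traversalBounds with Λ = closure of a bounded neighbourhood of Ω (compact), d =
2 covering numbers (exists_finset_card_le_cover_closedBall), T = (0, δ₀], X_δ = the SAW polyline;
hypothesis (H0) (no k traversals of shells of inner radius ≤ δ) holds for self-avoiding polylines of
step δ once k exceeds an absolute constant (a SAW uses each of the ≤ 12 edges within δ of x at most
once), so replace k by max k k₀ using HasTraversals.of_le. [difficulty: provable-now] -/
@[route_item "route-CriticalPhenomena-SAWRenewalTightness"]
def TightOfShellCrossing : Prop :=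
  ShellCrossingBound → EventualTight

-- `TightOfShellCrossing` holds: proved by `Summit.CriticalPhenomena.SAWScalingLimit.Theorems.TightOfShellCrossing_proof` (its module imports this route file, so no `_holds` link can be stated here).

/-- item stmt-CriticalPhenomena-4733 · support · rank 9 · closed · proved by Summit.CriticalPhenomena.SAWScalingLimit.Theorems.KestenIdentity_proof (prover) · by planner
sources: Kesten1963SAW, MadrasSlade1993 (4.2.4) and Cor. 3.1.8
[support] Kesten's criticality identity Σ_{β irreducible bridge} x_c^{|β|} = 1 (HasSum over the word
model SAW.IsIrrBridge of SAWWordBridges.lean): MadrasSlade1993 (4.2.4) — A_{z_c} ≤ 1 from b_n ≤ μ^n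
(in tree: Zd.bridgeCount_le_pow) and the renewal equation B = 1/(1−A) with unique decoding (in tree:
Renewal.eq_of_append_eq), A_{z_c} ≥ 1 because B_z diverges at z_c (Cor. 3.1.8: every half-space walk
decomposes into bridges of distinct spans, H_z ≤ exp(B_z − 1), and χ(z) ≥ z_c/(z_c − z), in tree:
criticalPoint_div_le_susceptibility, count_le_sum_halfSpaceCount, unfold_code_injOn). The tool
behind r3; a known theorem, hence support. [difficulty: M] -/
@[route_item "route-CriticalPhenomena-SAWRenewalTightness"]
def KestenIdentity : Prop :=
  HasSum (fun w : {w : List Literature.Probability.RandomPlanarGeometry.SAW.Step // Literature.Probability.RandomPlanarGeometry.SAW.IsIrrBridge w} => Literature.Probability.RandomPlanarGeometry.SAW.criticalFugacity ^ w.1.length) 1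

-- `KestenIdentity` holds: proved by `Summit.CriticalPhenomena.SAWScalingLimit.Theorems.KestenIdentity_proof` (its module imports this route file, so no `_holds` link can be stated here).

/-- item stmt-CriticalPhenomena-4734 · support · rank 9 · closed · proved by Summit.CriticalPhenomena.SAWScalingLimit.Theorems.stripMassConservation_proof (prover) · by planner
sources: MadrasSlade1993 §4.2 (4.2.9)-(4.2.12), Kesten1963SAW
[support] the strip prototype of r3: for every span L ≥ 1 the x_c-mass of bridges of span L from the
origin (vertex-function bridges Zd.bridges of SAWBridges.lean, span = first coordinate of the
endpoint) is ≤ 1 (all partial sums) — the span-renewal probability u_L of the renewal process with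
inter-arrival law p_ℓ = A_{z_c}(span ℓ), Σ p_ℓ = 1 by KestenIdentity (MadrasSlade1993
(4.2.9)–(4.2.12) at z = z_c, m(z_c) = 0). [difficulty: M] -/
@[route_item "route-CriticalPhenomena-SAWRenewalTightness"]
def StripMassConservation : Prop :=
  ∀ (L : ℤ), 1 ≤ L → ∀ N : ℕ, (∑ n ∈ Finset.range (N + 1), ∑ _ω ∈ (Literature.Probability.RandomPlanarGeometry.SAW.Zd.bridges 2 n).filter (fun ω => ω n 0 = L), Literature.Probability.RandomPlanarGeometry.SAW.criticalFugacity ^ n) ≤ 1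

-- `StripMassConservation` holds: proved by `Summit.CriticalPhenomena.SAWScalingLimit.Theorems.stripMassConservation_proof` (its module imports this route file, so no `_holds` link can be stated here).

/-- item stmt-CriticalPhenomena-4538 · assembly · rank 1 · closed · proved by Summit.CriticalPhenomena.SAWScalingLimit.Theorems.frontierHomotopy_tightIdentificationGlue_proof @ cf29ad9b5131 (prover) · by planner
sources: KemppainenSmirnov2017, LawlerSchrammWerner2004SAW, Literature.Probability.RandomPlanarGeometry.CurveClass.polishSpace_holds, Literature.Probability.RandomPlanarGeometry.exists_isSLECurve_eightThirds
[support] the common tail of the SAW routes: EventualTight → SubseqIdentification → SAWScalingLimit.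
Proof plan: for each (D, a, b) with IsEndpointApprox the laws SAW.law are probability measures for
all small δ (reachability ⇒ weight univ ≠ 0; finitely many SAWs in bounded Ω_δ ⇒ < ∞), so replace
them by a probability-valued family with the same germ at 0⁺ (ConvergesInLawToSLE, IsTightAlongMesh,
IsSubseqLimitLaw only see the germ), then apply the PROVED
Literature.Probability.RandomPlanarGeometry.convergesInLawToSLE_of_isTightAlongMesh with huniq :=
IsSLECurve.map_eq_holds, hY := SAW.aemeasurable_curve, and unfold SAWScalingLimit. [difficulty:
provable-now] -/
@[route_item "route-CriticalPhenomena-SAWRenewalTightness"]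
def Assembly : Prop :=
  EventualTight → SubseqIdentification → SAWScalingLimit

-- `Assembly` holds: proved by `Summit.CriticalPhenomena.SAWScalingLimit.Theorems.frontierHomotopy_tightIdentificationGlue_proof` @ cf29ad9b5131 (its module imports this route file, so no `_holds` link can be stated here).

/-! D-0027 §2.1 — DECIDING THEOREM (planner-authored via `route open/edit --closes-file`; by planner-rbadge-CriticalPhenomena-SAWRenewalTig-2cec5a99-g4-0 2026-08-15T16:53:33Z):
its hypotheses are this route's items and its conclusion the sub-problem Statement (glue_lint), and it elaborates with this file. -/

@[closes "route-CriticalPhenomena-SAWRenewalTightness"] theorem closes (hT : EventualTight) (hI : SubseqIdentification) : _root_.SAWScalingLimit := by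
  intro D a b hab
  classical
  -- Deciding theorem (D-0027 §2.1): eventual tightness of the pushed critical SAW laws (T′) and
  -- identification of every subsequential weak limit as the chordal SLE_{8/3} law (I) imply
  -- `SAWScalingLimit`, via the PROVED criterion `convergesInLawToSLE_of_isTightMeasureSet_image'`
  -- (Prokhorov + subsequence principle + uniqueness of the SLE law, `SLEUniquenessInLaw.lean`),
  -- applied to a surrogate family of probability laws on `CurveClass ℂ` that agrees with the pushed
  -- SAW laws for all small `δ` (where the SAW law is a probability measure: `a_δ, b_δ` are joined and
  -- `Ω_δ` is finite), and transferred back along `𝓝[>] 0` by eventual equality of the integrals.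
  -- (0) the critical fugacity `x_c = 1/μ(ℤ²)` is positive (`μ ≥ 1`, in tree)
  have hxc : 0 < Literature.Probability.RandomPlanarGeometry.SAW.criticalFugacity := by
    have h := Literature.Probability.RandomPlanarGeometry.SAW.Zd.connectiveConstant_pos 2
    rw [Literature.Probability.RandomPlanarGeometry.SAW.Zd.connectiveConstant_two] at h
    unfold Literature.Probability.RandomPlanarGeometry.SAW.criticalFugacity
    exact inv_pos.2 h
  -- (1) for all small `δ > 0` the critical SAW law of `Ω_δ` from `a_δ` to `b_δ` is a probability
  -- measure: `a_δ, b_δ` are joined (a SAW exists, positive weight) and `Ω_δ` is finite (finitely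
  -- many SAWs, finite total weight)
  have hprob : ∀ᶠ δ in 𝓝[>] (0 : ℝ), IsProbabilityMeasure
      (Literature.Probability.RandomPlanarGeometry.SAW.law D.carrier δ (a δ) (b δ)) := by
    filter_upwards [hab.reachable, self_mem_nhdsWithin] with δ hreach hδpos
    have hδ : (0 : ℝ) < δ := hδpos
    have hfin : (Literature.Probability.LatticeModels.meshDomain D.carrier δ).Finite :=
      Literature.Probability.LatticeModels.meshDomain_finite D.isBounded hδ
    haveI hLF : (Literature.Probability.LatticeModels.discreteDomainGraph D.carrier δ).LocallyFinite :=
      fun v => (hfin.subset fun w hw =>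
        (Literature.Probability.LatticeModels.discreteDomainGraph_adj_iff.1
          ((SimpleGraph.mem_neighborSet _ _ _).1 hw)).2.2).fintype
    -- every vertex of a walk of `Ω_δ` after the first lies in `Ω_δ`
    have hsupp : ∀ {u v : Literature.Probability.LatticeModels.Site 2}
        (p : (Literature.Probability.LatticeModels.discreteDomainGraph D.carrier δ).Walk u v),
        ∀ w ∈ p.support.tail, w ∈ Literature.Probability.LatticeModels.meshDomain D.carrier δ := by
      intro u v p
      induction p with
      | nil => intro w hw; simp at hw
      | cons h q ih =>
        intro w hw
        rw [SimpleGraph.Walk.support_cons, List.tail_cons, SimpleGraph.Walk.mem_support_iff] at hw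
        rcases hw with rfl | hw
        · exact (Literature.Probability.LatticeModels.discreteDomainGraph_adj_iff.1 h).2.2
        · exact ih w hw
    -- hence a self-avoiding walk of `Ω_δ` has at most `|Ω_δ|` steps
    have hlen : ∀ {u v : Literature.Probability.LatticeModels.Site 2}
        (p : (Literature.Probability.LatticeModels.discreteDomainGraph D.carrier δ).Walk u v),
        p.IsPath → p.length < hfin.toFinset.card + 1 := by
      intro u v p hp
      have hnd : p.support.tail.Nodup := List.Nodup.sublist (List.tail_sublist _) hp.support_nodup
      have h1 : p.support.tail.length = p.length := by
        rw [List.length_tail, SimpleGraph.Walk.length_support]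
        rfl
      have h2 : p.support.tail.toFinset ⊆ hfin.toFinset := by
        intro w hw
        rw [Set.Finite.mem_toFinset]
        exact hsupp p w (List.mem_toFinset.1 hw)
      have h3 := Finset.card_le_card h2
      rw [List.toFinset_card_of_nodup hnd, h1] at h3
      omega
    haveI hfinite : Finite
        (Literature.Probability.RandomPlanarGeometry.SAW.DomainSAW D.carrier δ (a δ) (b δ)) := by
      refine Finite.of_injective
        (β := {p : (Literature.Probability.LatticeModels.discreteDomainGraph D.carrier δ).Walk
          (a δ) (b δ) // p.IsPath ∧ p.length < hfin.toFinset.card + 1})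
        (fun γ => ⟨γ.walk, γ.isPath, hlen γ.walk γ.isPath⟩) ?_
      rintro ⟨p, hp⟩ ⟨q, hq⟩ h
      have hpq : p = q := congrArg Subtype.val h
      cases hpq
      rfl
    haveI := Fintype.ofFinite
      (Literature.Probability.RandomPlanarGeometry.SAW.DomainSAW D.carrier δ (a δ) (b δ))
    -- total weight: finite …
    have huniv : Literature.Probability.RandomPlanarGeometry.SAW.weight D.carrier δ (a δ) (b δ)
        Set.univ = ∑' γ : Literature.Probability.RandomPlanarGeometry.SAW.DomainSAW D.carrier δ
          (a δ) (b δ), ENNReal.ofReal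
            (Literature.Probability.RandomPlanarGeometry.SAW.criticalFugacity ^ γ.length) := by
      rw [Literature.Probability.RandomPlanarGeometry.SAW.weight,
        MeasureTheory.Measure.sum_apply _ MeasurableSet.univ]
      simp
    have htop : Literature.Probability.RandomPlanarGeometry.SAW.weight D.carrier δ (a δ) (b δ)
        Set.univ ≠ ⊤ := by
      rw [huniv, tsum_fintype]
      exact ENNReal.sum_ne_top.2 fun _ _ => ENNReal.ofReal_ne_top
    -- … and positive
    have h0 : Literature.Probability.RandomPlanarGeometry.SAW.weight D.carrier δ (a δ) (b δ)
        Set.univ ≠ 0 := by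
      obtain ⟨p⟩ := hreach
      let γ₀ : Literature.Probability.RandomPlanarGeometry.SAW.DomainSAW D.carrier δ (a δ) (b δ) :=
        ⟨p.bypass, p.bypass_isPath⟩
      have h1 : Literature.Probability.RandomPlanarGeometry.SAW.weight D.carrier δ (a δ) (b δ) {γ₀}
          ≤ Literature.Probability.RandomPlanarGeometry.SAW.weight D.carrier δ (a δ) (b δ)
            Set.univ := measure_mono (Set.subset_univ _)
      rw [Literature.Probability.RandomPlanarGeometry.SAW.weight_singleton] at h1
      have h2 : 0 < ENNReal.ofReal
          (Literature.Probability.RandomPlanarGeometry.SAW.criticalFugacity ^ γ₀.length) :=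
        ENNReal.ofReal_pos.2 (pow_pos hxc _)
      exact (h2.trans_le h1).ne'
    constructor
    rw [Literature.Probability.RandomPlanarGeometry.SAW.law, Measure.smul_apply, smul_eq_mul,
      ENNReal.inv_mul_cancel h0 htop]
  -- (2) surrogate family of probability laws on the curve space, equal to the pushed SAW laws
  -- for all small `δ`
  obtain ⟨ν, hν⟩ : ∃ ν : ℝ → Measure (Literature.Probability.RandomPlanarGeometry.CurveClass ℂ),
      ∀ δ, ν δ = if IsProbabilityMeasure
          (Literature.Probability.RandomPlanarGeometry.SAW.law D.carrier δ (a δ) (b δ)) then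
        (Literature.Probability.RandomPlanarGeometry.SAW.law D.carrier δ (a δ) (b δ)).map
          (fun γ => γ.curve)
        else Measure.dirac (Literature.Probability.RandomPlanarGeometry.CurveClass.mk
          (Literature.Probability.RandomPlanarGeometry.Curve.const 0)) :=
    ⟨_, fun _ => rfl⟩
  have hν_of : ∀ δ, IsProbabilityMeasure
      (Literature.Probability.RandomPlanarGeometry.SAW.law D.carrier δ (a δ) (b δ)) →
      ν δ = (Literature.Probability.RandomPlanarGeometry.SAW.law D.carrier δ (a δ) (b δ)).map
        (fun γ => γ.curve) := fun δ h => by rw [hν δ, if_pos h]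
  have hνprob : ∀ δ, IsProbabilityMeasure (ν δ) := by
    intro δ
    by_cases h : IsProbabilityMeasure
        (Literature.Probability.RandomPlanarGeometry.SAW.law D.carrier δ (a δ) (b δ))
    · rw [hν_of δ h]
      exact Measure.isProbabilityMeasure_map
        (Literature.Probability.RandomPlanarGeometry.SAW.aemeasurable_curve _ _ _ _)
    · rw [hν δ, if_neg h]
      infer_instance
  -- (3) the convergence criterion (Prokhorov + subsequence principle + uniqueness of the SLE law,
  -- all proved in tree) applied to the surrogate family
  have key : Literature.Probability.RandomPlanarGeometry.ConvergesInLawToSLE ((8 : NNReal) / 3) D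
      (Ωδ := fun _ : ℝ => Literature.Probability.RandomPlanarGeometry.CurveClass ℂ)
      (fun (_ : ℝ) (x : Literature.Probability.RandomPlanarGeometry.CurveClass ℂ) => x) ν := by
    haveI : ∀ δ, IsProbabilityMeasure (ν δ) := hνprob
    obtain ⟨δ₁, hδ₁, hsub₁⟩ := mem_nhdsGT_iff_exists_Ioo_subset.1 hprob
    obtain ⟨δ₀, hδ₀, htight⟩ := hT D a b hab
    have hδ₁' : (0 : ℝ) < δ₁ := hδ₁
    refine Literature.Probability.RandomPlanarGeometry.convergesInLawToSLE_of_isTightMeasureSet_image'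
      (Filter.Eventually.of_forall fun δ => aemeasurable_id') (δ₀ := min δ₀ (δ₁ / 2))
      (lt_min hδ₀ (half_pos hδ₁')) ?_ ?_
    · refine htight.subset ?_
      rintro _ ⟨δ, hδ, rfl⟩
      have hmem₀ : δ ∈ Set.Ioc 0 δ₀ := ⟨hδ.1, hδ.2.trans (min_le_left _ _)⟩
      have hmem₁ : δ ∈ Set.Ioo 0 δ₁ :=
        ⟨hδ.1, (hδ.2.trans (min_le_right _ _)).trans_lt (half_lt_self hδ₁')⟩
      have hp : IsProbabilityMeasure
          (Literature.Probability.RandomPlanarGeometry.SAW.law D.carrier δ (a δ) (b δ)) := hsub₁ hmem₁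
      refine ⟨δ, hmem₀, ?_⟩
      beta_reduce
      rw [Measure.map_id', hν_of δ hp]
    · intro μ hμ hsubseq
      obtain ⟨s, hs, hlim⟩ := hsubseq
      refine hI D a b hab s μ hs hμ fun f => ?_
      have hev : ∀ᶠ n in atTop, IsProbabilityMeasure
          (Literature.Probability.RandomPlanarGeometry.SAW.law D.carrier (s n) (a (s n)) (b (s n))) :=
        hs.eventually hprob
      refine (hlim f).congr' ?_
      filter_upwards [hev] with n hn
      beta_reduce
      rw [hν_of _ hn, integral_map
        (Literature.Probability.RandomPlanarGeometry.SAW.aemeasurable_curve _ _ _ _)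
        f.continuous.aestronglyMeasurable]
  -- (4) transfer back to the SAW laws, which agree with the surrogate family for small `δ`
  obtain ⟨Γ, hΓ, -, hlaw⟩ := key
  refine ⟨Γ, hΓ, Filter.Eventually.of_forall fun δ =>
    Literature.Probability.RandomPlanarGeometry.SAW.aemeasurable_curve _ _ _ _, fun f => ?_⟩
  refine (hlaw f).congr' ?_
  filter_upwards [hprob] with δ hδ
  beta_reduce
  rw [hν_of δ hδ, integral_map
    (Literature.Probability.RandomPlanarGeometry.SAW.aemeasurable_curve _ _ _ _)
    f.continuous.aestronglyMeasurable]

end Summit.CriticalPhenomena.SAWScalingLimit.Theses.SAWRenewalTightness
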